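import Literature.NumberTheory.Automorphic.LanglandsTunnellReduction
import Literature.NumberTheory.Automorphic.LanglandsTunnellModThree
import Literature.NumberTheory.GaloisRepresentations.ArtinCharacterReciprocityProofs
import Literature.NumberTheory.Automorphic.TunnellOctahedralGlobalProofs
import Literature.NumberTheory.Automorphic.PiOfArtinRepFrobSatakeCompatibleProofs
import Literature.GroupTheory.SpecificGroups.GL2SubgroupContainsSL2
import Mathlib.NumberTheory.NumberField.CMField
import HarnessLib

/-!
# Stub-ideation k = 2, GENERATION 9 (home family 2 — RESHAPE) for `stub_modThree`

Companion of `STUB-IDEAS-stub_modThree-2.md` (gen 9).  Nothing registered; the stub statement is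
copied verbatim as `SigStubModThree`.

* `stubModThree_of_open_leaves` (R1, carried from gen 8, PROVED): the typed stub from the eight
  currently OPEN leaves of the tree's Langlands–Tunnell decomposition — the stub's exact trust base.
* `B0_…`, `B0'_…` (S, decidable size), `B1_…`, `B2_…` (M–L): the **GL₂(𝔽₃) normal-closure
  barrier** that closes the RESHAPE sub-family "weaken the base field and bootstrap"
  (Skinner–Wiles / potential residual modularity over a totally real `F`, CM-field descent):
  the mod-3 image of an odd surjective `ρ̄` does not shrink over any totally real field and keeps
  `SL₂(𝔽₃)` over any CM field, so no such base change leaves the octahedral/tetrahedral cell.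
  These are NEGATIVE knowledge: they enter no assembly of the stub.
* `B0i_upper`, `B0i_lower` (kernel-checked identities): an upper / lower transvection of
  `GL₂(𝔽₃)` is a product of two conjugates of `diag(1,-1)` — the two-word proof of `B0` in the
  involution case via the tree's `toGL_mem_of_transvections_mem`.
-/

noncomputable section

open scoped MatrixGroups NumberField
open Literature.NumberTheory.EllipticCurves
open Literature.NumberTheory.Automorphic
open Literature.NumberTheory.GaloisRepresentations
open WeierstrassCurve

set_option linter.dupNamespace false

namespace Summit.ABC.ABC.Cruxes.FreyModularity.StubModThreeIdeasK2G9

/-- The registered stub statement, verbatim. -/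
def SigStubModThree : Prop :=
  ∀ (W : WeierstrassCurve ℚ) [W.IsElliptic] (ρ : ModPGaloisRep ℚ (ZMod 3) 2),
    W.IsTorsionGaloisRep 3 ρ → FramedRep.IsAbsolutelyIrreducible ρ → ρ.IsModular

/-! ## R1 (carried, PROVED) — the stub from the eight OPEN leaves -/

/-- **R1.** The typed stub from the eight open leaves of `langlands_tunnell_of_leaves`; the three
discharged leaves are fed by their `_holds` theorems. -/
theorem stubModThree_of_open_leaves
    (hAI : automorphicInduction_character)
    (hdesc3 : exists_cuspidal_descent_det_cubic) (hGJ : GelbartJacquet_adjoint_lift)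
    (hJS : JacquetShalika_eq_of_rsData_eq) (hdesc : cuspidal_descent_cyclic)
    (ha : ArthurClozel_fibres_quadratic) (hb : tunnell_cuspidal_cubic_lifts)
    (hW1 : exists_isNewform1_of_isPiOfArtinRep) : SigStubModThree :=
  fun W _ ρ hρ habs ↦
    W.isModular_of_isTorsionGaloisRep_three_of_langlands_tunnell
      (langlands_tunnell_of_leaves artinReciprocity_character_holds hAI hdesc3 hGJ hJS hdesc
        exists_twist_quadraticSign_holds ha hb frobSatakeCompatibleAt_of_isPiOfArtinRep_holds hW1)
      ρ hρ habs

/-! ## The GL₂(𝔽₃) normal-closure barrier (negative knowledge for base-field reshapes) -/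

/-- `d = diag(1,-1) ∈ GL₂(𝔽₃)`: the image of complex conjugation under an odd `ρ̄` (up to
conjugacy: every involution of determinant `-1` is conjugate to `d`). -/
def dConj : GL (Fin 2) (ZMod 3) :=
  Matrix.GeneralLinearGroup.mkOfDetNeZero !![1, 0; 0, -1] (by decide)

/-- The upper transvection `U(1) = (1 1; 0 1)`. -/
def uUpper : GL (Fin 2) (ZMod 3) :=
  Matrix.GeneralLinearGroup.mkOfDetNeZero !![1, 1; 0, 1] (by decide)

/-- `U(1)⁻¹ = U(2)`, given explicitly (so that the identities below are kernel-decidable). -/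
def uUpperInv : GL (Fin 2) (ZMod 3) :=
  Matrix.GeneralLinearGroup.mkOfDetNeZero !![1, 2; 0, 1] (by decide)

/-- The lower transvection `L(1) = (1 0; 1 1)`. -/
def uLower : GL (Fin 2) (ZMod 3) :=
  Matrix.GeneralLinearGroup.mkOfDetNeZero !![1, 0; 1, 1] (by decide)

/-- `L(1)⁻¹ = L(2)`. -/
def uLowerInv : GL (Fin 2) (ZMod 3) :=
  Matrix.GeneralLinearGroup.mkOfDetNeZero !![1, 0; 2, 1] (by decide)

theorem uUpper_mul_uUpperInv : uUpper * uUpperInv = 1 := by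
  decide

theorem uLower_mul_uLowerInv : uLower * uLowerInv = 1 := by
  decide

/-- **B0i (upper).** `U(1) = d · (U(1) d U(1)⁻¹)`: an upper transvection is a product of two
conjugates of `d` (over `𝔽₃`, `d · U(t) d U(t)⁻¹ = U(-2t) = U(t)`). -/
theorem B0i_upper : dConj * (uUpper * dConj * uUpperInv) = uUpper := by
  decide

/-- **B0i (lower).** `L(1) = d · (L(1) d L(1)⁻¹)`. -/
theorem B0i_lower : dConj * (uLower * dConj * uLowerInv) = uLower := by
  decide

/-- **B0 (S).** A normal subgroup of `GL₂(𝔽₃)` containing an element of determinant `≠ 1` is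
everything (normal subgroups: `1, {±1}, Q₈, SL₂(𝔽₃), GL₂(𝔽₃)`; only the last meets `det = -1`).
Involution case: `B0i_upper`/`B0i_lower` + `toGL_mem_of_transvections_mem` give `SL₂ ≤ H`, and
`det` separates the two cosets. -/
theorem B0_normal_eq_top_of_det_ne_one :
    ∀ H : Subgroup (GL (Fin 2) (ZMod 3)), H.Normal →
      ∀ c ∈ H, Matrix.GeneralLinearGroup.det c ≠ 1 → H = ⊤ := by
  sorry

/-- **B0′ (S).** `SL₂(𝔽₃) = ker det` is the unique subgroup of index `2` of `GL₂(𝔽₃)`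
(`[GL₂(𝔽₃), GL₂(𝔽₃)] = SL₂(𝔽₃)`). -/
theorem B0'_eq_ker_det_of_index_two :
    ∀ H : Subgroup (GL (Fin 2) (ZMod 3)), H.index = 2 →
      H = (Matrix.GeneralLinearGroup.det : GL (Fin 2) (ZMod 3) →* (ZMod 3)ˣ).ker := by
  sorry

/-- **B1 (M–L).** Over a totally real number field `F` the image of an odd surjective
`ρ̄ : Γ_ℚ → GL₂(𝔽₃)` does not shrink: `K ∩ F` (`K = ℚ(ρ̄)`) is totally real, hence fixed by
every complex conjugation, hence by their normal closure `= GL₂(𝔽₃)` (`B0`). -/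
theorem B1_surjective_restrictField_of_isTotallyReal :
    ∀ (F : Type) [Field F] [NumberField F] [NumberField.IsTotallyReal F]
      (ρ : ModPGaloisRep ℚ (ZMod 3) 2), Function.Surjective ρ → FramedGaloisRep.IsOdd ρ →
      Function.Surjective (ρ.restrictField F) := by
  sorry

/-- **B2 (M–L).** Over a CM field `F` the image still contains `SL₂(𝔽₃)` (projective image
`A₄` or `S₄`, never monomial): `B1` for `F⁺` and `B0′`. -/
theorem B2_sl_subset_range_restrictField_of_isCMField :
    ∀ (F : Type) [Field F] [NumberField F] [NumberField.IsCMField F]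
      (ρ : ModPGaloisRep ℚ (ZMod 3) 2), Function.Surjective ρ → FramedGaloisRep.IsOdd ρ →
      ∀ g : GL (Fin 2) (ZMod 3), Matrix.GeneralLinearGroup.det g = 1 →
        g ∈ Set.range (ρ.restrictField F) := by
  sorry

end Summit.ABC.ABC.Cruxes.FreyModularity.StubModThreeIdeasK2G9
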